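import Summits.Ventures.Crystal3D.Theorems.StickyWulffConstantGenericWallFloorBarlowLineCountOneSided
import Summits.Ventures.Crystal3D.Theorems.StickyWulffConstantGenericWallFloorBarlowOrientedGlueApart
import HarnessLib

/-!
# F4 glue for ONE up-presented plate under clause (i) of `FramesApart` alone: `barlow_hlines_oriented_oneSided`
# (crux `GenericWallFloor`, stmt-Ventures-19480, line `WallLedgerG`; lane T row (e) `stub_residualFaulted`, cf-p1 (lxxxviii)/(xc), K1a file 3
# of HOME/wall-p2-g10/FAULTED-LEDGER-MEMO.md)

HONEST FRAMING. Venture `Summits/Ventures/Crystal3D` (cell `crystal3d-full`), helper `--supports` the crux `GenericWallFloor`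
(stmt-Ventures-19480) of `route-Ventures-StickyWulffConstant`, registered line `WallLedgerG`.  Rung credit only; F-C1 not moved; NOT the
stub.  Inputs BY NAME: E1 (`ExactOnly`), `DoubleStarCoaxialAt` / `CapPairCoaxial`.

The plate-1 half of `barlow_hlines_oriented_apart` (`…BarlowOrientedGlueApart`): the bottom plate `(L₁, s₁, σ₁)` presented with its layer
index increasing along `e₃` (`0 ≤ (L₁⁻¹e₃)₂`), its CANONICAL family (slot `V₁ = best3 (⟪·, L₁⁻¹e₃⟫) upSlot₁ upSlot₂ upSlot₃ = famSlot`,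
machine steps, canonical states, `δ = 1/4`), Δ-steep, and the ONE separation hypothesis `hapart₁` = clause (i) of `FramesApart` for
`chainFrames e₃ L₁ V₁` (no chain frame carries the top plate's bilayer lattice `L₂·Λ₀` or its basal twin's).  NOTHING is assumed about
the top plate's family (no clause (ii)/(iii), no Δ-steepness of plate 2, no reach set, no registration): the top plate enters only as
the passive clamped sample.  Conclusion = lane T's `hlines` INNER SHAPE with the second family empty:
`∃ step₁, IsZigSelector L₁ σ₁ e₃ step₁ ∧ ∀ cell, ∃ m ≥ 0, ∃ T₁ ⊇ {window lines at lateral ≤ ρ − m}, #T₁ + 18·m·ρ ≤ Σ_PAY(12 − deg) +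
(318 + 192R₀)(1+h)ρ`.  This is the ledger half of the memo's K1a for the canonical slot; the chosen-slot version (any steep reference
upper slot `v`, which `barlow_lineCount_le_payers_oneSided` already allows) waits for lane T's selector-at-`v` vocabulary.
* **`barlow_hlines_oriented_oneSided`**.
WHAT THIS IS NOT: not the T-side cell inequality (tables `c i j ≤ ½·plateFlux₁ i`: wulff-p2's one-family copy of
`bilayerWallWalkerCoveredAt_of_F4`); not the `axisSign = −1` presentation; F-C1 not moved.
-/

noncomputable section

namespace Summit.Ventures.Crystal3D.Theorems

open Finset
open Literature.MathematicalPhysics.StatisticalMechanics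
open Summit.Ventures.Crystal3D.Cruxes.TextureLiminf.TexShadow (stacking cyl upSlot₁ upSlot₂ upSlot₃ bilayerRise)
open scoped InnerProductSpace

/-- **F4 glue for ONE up-presented plate, clause (i) only.**  See the module docstring. -/
theorem barlow_hlines_oriented_oneSided
    {sE : EuclideanSpace ℝ (Fin 3)} (hsE : sE ∈ fccSlots) (hcert : ExactOnly 0 (fccSlots.filter fun w => 0 < ⟪w, sE⟫_ℝ))
    (hDS : ∀ F₁ F₂ : EuclideanSpace ℝ (Fin 3) ≃ₗᵢ[ℝ] EuclideanSpace ℝ (Fin 3), DoubleStarCoaxialAt F₁ F₂) (hCP : CapPairCoaxial)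
    {σ₁ σ₂ : ℤ → ℤ} (hσ₁ : IsHaggSeq σ₁) (hσ₂ : IsHaggSeq σ₂)
    (L₁ L₂ : EuclideanSpace ℝ (Fin 3) ≃ₗᵢ[ℝ] EuclideanSpace ℝ (Fin 3)) (s₁ s₂ : EuclideanSpace ℝ (Fin 3))
    (hax₁ : 0 ≤ (L₁.symm (EuclideanSpace.single (2 : Fin 3) (1 : ℝ))) 2)
    (hsteep₁ : Real.sqrt 2 / 2 ≤ ⟪L₁ (best3 (fun w => ⟪w, L₁.symm (EuclideanSpace.single (2 : Fin 3) (1 : ℝ))⟫_ℝ) upSlot₁ upSlot₂ upSlot₃),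
      EuclideanSpace.single (2 : Fin 3) (1 : ℝ)⟫_ℝ)
    (hapart₁ : ∀ F ∈ chainFrames (EuclideanSpace.single (2 : Fin 3) (1 : ℝ)) L₁
        (best3 (fun w => ⟪w, L₁.symm (EuclideanSpace.single (2 : Fin 3) (1 : ℝ))⟫_ℝ) upSlot₁ upSlot₂ upSlot₃),
      F '' fccStacking 1 (Real.sqrt (2 / 3)) ≠ L₂ '' fccStacking 1 (Real.sqrt (2 / 3)) ∧
      F '' fccStacking 1 (Real.sqrt (2 / 3)) ≠
        (twinFrame L₂ (L₂ (EuclideanSpace.single (2 : Fin 3) (1 : ℝ)))) '' fccStacking 1 (Real.sqrt (2 / 3)))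
    (R₀ : ℝ) (hR₀ : 6 ≤ R₀) :
    ∃ step₁ : ℤ → EuclideanSpace ℝ (Fin 3),
      IsZigSelector L₁ σ₁ (EuclideanSpace.single (2 : Fin 3) (1 : ℝ)) step₁ ∧
      ∀ h : ℝ, 0 ≤ h → ∀ ρ : ℝ, R₀ ≤ ρ → ∀ X P₁ P₂ : Finset (EuclideanSpace ℝ (Fin 3)),
      (∀ p ∈ X, ∀ q ∈ X, p ≠ q → 1 ≤ dist p q) → P₁ ⊆ X → P₂ ⊆ X \ P₁ → (∀ p ∈ X, p ∈ cyl R₀ h ρ) →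
      (∀ p, p ∈ P₁ ↔ (p ∈ stacking L₁ s₁ σ₁ ∧ -(2 * R₀) ≤ p 2 ∧ p 2 ≤ -R₀ ∧ p 0 ^ 2 + p 1 ^ 2 ≤ ρ ^ 2)) →
      (∀ p, p ∈ P₂ ↔ (p ∈ stacking L₂ s₂ σ₂ ∧ h + R₀ ≤ p 2 ∧ p 2 ≤ h + 2 * R₀ ∧ p 0 ^ 2 + p 1 ^ 2 ≤ ρ ^ 2)) →
      ∃ (m : ℝ) (T₁ : Finset (Fin 2 → ℤ)), 0 ≤ m ∧
        (∀ t : Fin 2 → ℤ, (∃ k : ℤ,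
          -R₀ - 4 ≤ (L₁ (zigVertexS step₁ k + ((t 0 : ℝ) • triangularVec₁ 1 + (t 1 : ℝ) • triangularVec₂ 1)) + s₁) 2 ∧
          (L₁ (zigVertexS step₁ k + ((t 0 : ℝ) • triangularVec₁ 1 + (t 1 : ℝ) • triangularVec₂ 1)) + s₁) 2 ≤ -R₀ - 3 ∧
          Real.sqrt ((L₁ (zigVertexS step₁ k + ((t 0 : ℝ) • triangularVec₁ 1 + (t 1 : ℝ) • triangularVec₂ 1)) + s₁) 0 ^ 2 +
            (L₁ (zigVertexS step₁ k + ((t 0 : ℝ) • triangularVec₁ 1 + (t 1 : ℝ) • triangularVec₂ 1)) + s₁) 1 ^ 2) ≤ ρ - m) →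
          t ∈ T₁) ∧
        (T₁.card : ℝ) + 18 * m * ρ ≤
          (∑ y ∈ X.filter (fun y => (X.filter fun q => dist y q = 1).card ≠ 12 ∧ -R₀ - 2 ≤ y 2 ∧ y 2 ≤ h + R₀ + 2),
            ((12 : ℝ) - ((X.filter fun q => dist y q = 1).card : ℝ))) + (318 + 192 * R₀) * (1 + h) * ρ := by
  set e₃ : EuclideanSpace ℝ (Fin 3) := EuclideanSpace.single (2 : Fin 3) (1 : ℝ) with he₃
  have he₃n : ‖e₃‖ = 1 := by rw [he₃, PiLp.norm_single, norm_one]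
  -- the family slot, ∇ slot, machine steps, canonical states, selector
  set V₁ := best3 (fun w => ⟪w, L₁.symm e₃⟫_ℝ) upSlot₁ upSlot₂ upSlot₃ with hV₁
  set G₁ := twinFrame L₁ (L₁ e₃) with hG₁
  set q₁ := bestCapper G₁ (L₁ e₃) e₃ with hq₁
  set ms₁ : ℤ → EuclideanSpace ℝ (Fin 3) := fun m => if σ₁ m = 1 then V₁ else basalMirror q₁ with hms₁
  set canon₁ : ℤ → EuclideanSpace ℝ (Fin 3) → EuclideanSpace ℝ (Fin 3) × List WalkEntry :=
    fun m t => if σ₁ (m - 1) = 1 then (t, [⟨L₁, V₁, 0⟩]) else (t, [⟨G₁, q₁, L₁ e₃⟩, ⟨L₁, V₁, 0⟩]) with hcanon₁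
  have hne : ¬ ((-1 : ℤ) = 1) := by decide
  have hms₁₁ : ∀ m, σ₁ m = 1 → ms₁ m = V₁ := fun m hm => by simp only [hms₁, hm, if_true]
  have hms₁₂ : ∀ m, σ₁ m = -1 → ms₁ m = basalMirror q₁ := fun m hm => by simp only [hms₁, hm, hne, if_false]
  have hcanon₁₁ : ∀ m t, σ₁ (m - 1) = 1 → canon₁ m t = (t, [⟨L₁, V₁, 0⟩]) := fun m t hm => by simp only [hcanon₁, hm, if_true]
  have hcanon₁₂ : ∀ m t, σ₁ (m - 1) = -1 → canon₁ m t = (t, [⟨G₁, q₁, L₁ e₃⟩, ⟨L₁, V₁, 0⟩]) := fun m t hm => by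
    simp only [hcanon₁, hm, hne, if_false]
  set step₁ : ℤ → EuclideanSpace ℝ (Fin 3) := fun k => ms₁ (zigSlab L₁ e₃ k) with hstep₁
  have hsel₁ : IsZigSelector L₁ σ₁ e₃ step₁ := isZigSelector_machineStep σ₁ L₁ e₃ V₁ ms₁ hσ₁ hax₁ hV₁ hms₁₁ hms₁₂
  refine ⟨step₁, hsel₁, ?_⟩
  intro h hh ρ hρ X P₁ P₂ hX hP₁X hP₂X' hcyl hP₁ hP₂
  have hP₂X : P₂ ⊆ X := hP₂X'.trans Finset.sdiff_subset
  have hcell : ∀ p ∈ X, -(2 * R₀) ≤ p 2 ∧ p 2 ≤ h + 2 * R₀ ∧ p 0 ^ 2 + p 1 ^ 2 ≤ ρ ^ 2 := fun p hp => by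
    have := hcyl p hp; simpa only [cyl, Set.mem_setOf_eq] using this
  -- slot, rise
  obtain ⟨hV₁s, hV₁2, -⟩ := familySlot_spec σ₁ L₁ e₃ V₁ hax₁ hV₁
  have hδ₁ : ∀ m, (1 / 4 : ℝ) ≤ ⟪L₁ (ms₁ m), e₃⟫_ℝ := by
    intro m
    rw [inner_map_eq_inner_symm, (machineStep_spec σ₁ L₁ e₃ V₁ ms₁ hσ₁ hax₁ hV₁ hms₁₁ hms₁₂ m).1]
    exact quarter_le_bilayerRise L₁ σ₁ he₃n m
  -- the polyline
  have hslab₁ : ∀ k, zigSlab L₁ e₃ k = k := fun k => by unfold zigSlab; rw [if_pos hax₁]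
  have hsucc₁ : ∀ k, zigVertexS step₁ (k + 1) = zigVertexS step₁ k + ms₁ k := fun k => by
    rw [zigVertexS_succ]; simp only [hstep₁, hslab₁]
  have hlayer₁ : ∀ k, zigVertexS step₁ k ∈ barlowLayer 1 (Real.sqrt (2 / 3)) σ₁ k := fun k => by
    have := zigVertexS_mem_barlowLayer L₁ hσ₁ e₃ hsel₁ k
    unfold zigLayer at this; rwa [if_pos hax₁] at this
  -- the line count with explicit margin
  have hq : (1 : ℝ) / 4 > 0 := by norm_num
  obtain ⟨T₁, hT₁, hcount⟩ := barlow_lineCount_le_payers_oneSided hX hsE hcert hDS hCP hσ₁ hσ₂ L₁ L₂ s₁ s₂ R₀ h ρ hR₀ hh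
    (by linarith) P₁ P₂ hP₁X hP₂X hcell hP₁ hP₂ V₁ canon₁ ms₁ hV₁s hV₁2 hsteep₁ hcanon₁₁ hcanon₁₂ hms₁₁ hms₁₂ hq hδ₁ hapart₁
    (zigVertexS step₁) hsucc₁ hlayer₁
  set m : ℝ := 3 + 8 / 3 * (h + 4 * R₀) + 3 / (1 / 4) with hm
  have hmval : m = 15 + 8 / 3 * h + 32 / 3 * R₀ := by rw [hm]; ring
  have hm0 : 0 ≤ m := by rw [hmval]; nlinarith
  have hρ0 : 0 ≤ ρ := by linarith
  refine ⟨m, T₁, hm0, hT₁, ?_⟩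
  have hpen : 18 * m * ρ ≤ (318 + 192 * R₀) * (1 + h) * ρ := by
    rw [hmval]
    have h1 : 18 * (15 + 8 / 3 * h + 32 / 3 * R₀) ≤ (318 + 192 * R₀) * (1 + h) := by nlinarith
    exact mul_le_mul_of_nonneg_right h1 hρ0
  linarith

end Summit.Ventures.Crystal3D.Theorems

end
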